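import Literature.Topology.FourManifolds.CobordismMorseCountEuler
import Literature.Topology.FourManifolds.HCobordismIndexZeroOneProofs
import Literature.Topology.FourManifolds.ProductCobordismProofs
import Literature.Topology.FourManifolds.CobordismProofs
import Literature.Topology.FourManifolds.MorseTurnAbout
import Literature.Topology.FourManifolds.SimplifiedBrokenLefschetzCaps
import Literature.Topology.FourManifolds.OneManifoldOrientableGeneral
import Literature.Topology.FourManifolds.OneManifoldCircle
import HarnessLib

/-!
# The cylinder theorem for surfaces: a connected cobordism between non-empty closed
# `1`-manifolds with `χ = 0` is a product `S¹ × [0, 1]`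

Topic `Literature/Topology/FourManifolds`; a brick for the named fact
`Literature.Topology.FourManifolds.nonempty_diffeomorph_sphere_four_of_sblf_genus_one_noLefschetz`
(Baykur–Kamada 2015, Lemma 11) of `SimplifiedBrokenLefschetzFibration.lean`, whose printed proof
(Baykur–Kamada 2015, §2 and §5) identifies the higher side of a genus-`1` simplified broken
Lefschetz fibration with `T² × D²` — i.e. uses the classification of closed orientable surfaces in
genus `1` — and cuts tori along their circles.  The engine of that classification in the Morse /
handle language of the tree (Hirsch 1976, Ch. 9 §3, proof of Thm. 3.5 through Lemma 3.2 and
Thm. 3.7: *"an annulus is a disk with a `1`-handle attached"*; Milnor 1965, Thms. 3.4 and 8.1) is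
the **cylinder theorem** proved here.  Everything in this file is **proved**; there are no
definitions and no named facts.

* `Cobordism.exists_isMorseFunction_criticalSetOfIndex_zero_two_eq_empty` — on a CONNECTED
  surface cobordism `(W; M, N)` with `M ≠ ∅ ≠ N` there is a Morse function of the triad all of
  whose critical points are saddles: Milnor 1965, Thm. 8.1 Index 0 (the tree's theorem
  `Cobordism.Milnor1965_cancel_index_zero_holds`; its hypothesis `H₀(W, M) = 0` reads "every
  point is joined to `M`", true on the path-connected `W`), applied once to `(W; M, N)` and once
  to the turned-about triad `(W; N, M)` with `1 - g` (Milnor 1965, proof of Thm. 9.1; the tree's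
  `Cobordism.IsMorseFunction.symm`, `criticalSetOfIndex_one_sub`).
* `Cobordism.isTrivial_of_relEuler_eq_zero` — **the cylinder theorem**: if moreover
  `χ(W, M) = 0` then `W ≅ M × [0, 1]` relative to `M` (`Cobordism.IsTrivial`): by the Morse
  count (Milnor 1965, §3 and Thm. 7.4; the tree's `Cobordism.IsMorseFunction.relEuler_eq_sum_ncard`)
  the saddle-only Morse function has `-#crit₁ = χ(W, M) = 0` critical points, so Milnor's product
  theorem Thm. 3.4 (`Cobordism.isTrivial_of_isMorseFunction_holds`) applies.
* `Cobordism.isTrivial_of_relEuler_empty_eq_zero` — the same with the hypothesis `χ(W) = 0`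
  (`χ(W) = χ(M) + χ(W, M)`, `Cobordism.relEuler_eq_relEuler_end_add`, and `χ(M) = 0` for the
  closed `1`-manifold `M`, `finRelHomology_and_relEuler_eq_zero_of_even`).
* `Cobordism.connectedSpace_of_isTrivial`, `Cobordism.nonempty_diffeomorph_sphere_one_of_isTrivial`
  — the incoming end of a connected product cobordism of surfaces is connected, hence a circle
  (Milnor 1965, Appendix; the tree's `OneManifold.isOrientable`,
  `nonempty_diffeomorph_sphere_one_of_smoothOrientation`);
* `Cobordism.nonempty_diffeomorph_sphere_one_prod_Icc_of_relEuler_eq_zero` — **the annulus**: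
  under the hypotheses of the cylinder theorem `W ≅ S¹ × [0, 1]`, and both ends are circles
  (`…sphere_one_of_relEuler_eq_zero`, `…sphere_one_right_of_relEuler_eq_zero`).

Hirsch's Thm. 9.3.7 classifies compact connected orientable `∂`-surfaces by genus and number of
boundary circles; the case proved here is genus `0`, two boundary circles, in the cobordism form in
which it is used (cutting a closed surface at regular levels).  Orientability is not assumed: it
follows (`W ≅ S¹ × [0, 1]`).

## References

* M. W. Hirsch, *Differential Topology*, GTM 33 (1976), Ch. 9 §3: Lemma 3.2, Thm. 3.5 and its
  proof (*"`∂H₀ ≈ S¹` … an annulus"*), Thm. 3.7 (PDF pp. 186–189 of the held copy).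
  [HirschDT1976]
* J. Milnor, *Lectures on the h-cobordism theorem*, Princeton (1965), Thm. 2.5, Thm. 3.4, §3
  (PDF p. 21), Thm. 7.4, Thm. 8.1 Index 0 (PDF p. 54), proof of Thm. 9.1 (PDF p. 57), Appendix
  (classification of `1`-manifolds). [MilnorHCobordism1965]
* R. İ. Baykur, S. Kamada, *Classification of broken Lefschetz fibrations with small fiber
  genera*, J. Math. Soc. Japan 67 (2015), §2, §5, Lemma 11. [BaykurKamada2015]
-/

noncomputable section

open scoped Manifold ContDiff Topology
open Set Function
open Literature.AlgebraicTopology.SingularHomology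

namespace Literature.Topology.FourManifolds

universe u

namespace Cobordism

variable {M N : Type u} [TopologicalSpace M] [T2Space M] [SecondCountableTopology M]
  [ChartedSpace (EuclideanSpace ℝ (Fin 1)) M] [IsManifold (𝓡 1) ∞ M] [CompactSpace M]
  [TopologicalSpace N] [T2Space N] [SecondCountableTopology N]
  [ChartedSpace (EuclideanSpace ℝ (Fin 1)) N] [IsManifold (𝓡 1) ∞ N] [CompactSpace N]

/-! ### Saddles only -/

/-- **A connected surface cobordism with both ends non-empty carries a Morse function of the
triad without minima and maxima** (all critical points of index `1`): Milnor 1965, Thm. 8.1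
Index 0 on `(W; M, N)` — `H₀(W, M) = 0` because `W` is path connected and `M ≠ ∅` — removes the
critical points of index `0` without creating any of index `2`; the same on the turned-about
triad `(W; N, M)` with `1 - g` (proof of Thm. 9.1) removes those of index `2`.
[cite: MilnorHCobordism1965, Thm. 8.1 Index 0 (PDF p. 54) and proof of Thm. 9.1 (PDF p. 57)] -/
theorem exists_isMorseFunction_criticalSetOfIndex_zero_two_eq_empty (c : Cobordism 1 M N)
    [ConnectedSpace c.W] [Nonempty M] [Nonempty N] :
    ∃ g : c.W → ℝ, c.IsMorseFunction g ∧ criticalSetOfIndex (𝓡∂ (1 + 1)) g 0 = ∅ ∧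
      criticalSetOfIndex (𝓡∂ (1 + 1)) g 2 = ∅ := by
  haveI : LocallyPathConnectedSpace c.W :=
    ChartedSpace.locallyPathConnectedSpace (EuclideanHalfSpace (1 + 1)) c.W
  haveI : PathConnectedSpace c.W := pathConnectedSpace_iff_connectedSpace.mpr ‹_›
  obtain ⟨f, hf⟩ := c.exists_isMorseFunction_of
  -- Thm. 8.1 Index 0 on `(W; M, N)`
  have hH0 : ∀ z : c.W, ∃ x : M, Joined z (c.inl x) := fun z =>
    ⟨Classical.arbitrary M, PathConnectedSpace.joined z _⟩
  obtain ⟨g, hg, hg0, -, -, -⟩ := Cobordism.Milnor1965_cancel_index_zero_holds c hH0 f hf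
  -- turn the triad about and apply Thm. 8.1 Index 0 on `(W; N, M)` to `1 - g`
  have hg' := hg.symm
  have hH0' : ∀ z : c.symm.W, ∃ y : N, Joined z (c.symm.inl y) := fun z =>
    ⟨Classical.arbitrary N, PathConnectedSpace.joined (X := c.W) z _⟩
  obtain ⟨h, hh, hh0, -, -, hh2⟩ :=
    Cobordism.Milnor1965_cancel_index_zero_holds c.symm hH0' _ hg'
  -- turn back: `1 - h` on `(W; M, N)` (`c.symm.symm = c` definitionally)
  have hk : c.IsMorseFunction (fun z => 1 - h z) := hh.symm
  -- `crit₀(1 - h) = crit₂(h) = crit₂(1 - g) = crit₀(g) = ∅`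
  have e0 : criticalSetOfIndex (M := c.W) (𝓡∂ (1 + 1)) (fun z => 1 - h z) 0 = ∅ := by
    have h1 := hh.criticalSetOfIndex_one_sub (k := 0) (by norm_num)
    have h2 := hh2 2 le_rfl
    have h3 := hg.criticalSetOfIndex_one_sub (k := 2) le_rfl
    rw [show 1 + 1 - 0 = 2 from rfl, h2] at h1
    rw [show 1 + 1 - 2 = 0 from rfl, hg0] at h3
    exact h1.trans h3
  -- `crit₂(1 - h) = crit₀(h) = ∅`
  have e2 : criticalSetOfIndex (M := c.W) (𝓡∂ (1 + 1)) (fun z => 1 - h z) 2 = ∅ := by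
    have h1 := hh.criticalSetOfIndex_one_sub (k := 2) le_rfl
    rw [show 1 + 1 - 2 = 0 from rfl, hh0] at h1
    exact h1
  exact ⟨fun z => 1 - h z, hk, e0, e2⟩

/-! ### The cylinder theorem -/

/-- **The cylinder theorem (Hirsch 1976, Ch. 9 §3; Milnor 1965, Thms. 8.1 and 3.4 in dimension
`2`).**  A connected surface cobordism `(W; M, N)` between non-empty closed `1`-manifolds with
`χ(W, M) = 0` is a product: `W ≅ M × [0, 1]` relative to `M`.  Proof: take a Morse function of
the triad with saddles only (`exists_isMorseFunction_criticalSetOfIndex_zero_two_eq_empty`); by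
the Morse count `χ(W, M) = #crit₀ - #crit₁ + #crit₂ = -#crit₁` it has no critical point at all,
and Milnor's product theorem applies.
[cite: HirschDT1976, Ch. 9 §3, Thm. 3.7 and proof of Thm. 3.5 (PDF pp. 188–189)]
[cite: MilnorHCobordism1965, Thm. 3.4, §3 (PDF p. 21) with Thm. 7.4, Thm. 8.1 Index 0 (PDF p. 54)] -/
theorem isTrivial_of_relEuler_eq_zero (c : Cobordism 1 M N) [ConnectedSpace c.W] [Nonempty M]
    [Nonempty N] (hχ : relEuler ℤ ℤ c.W (range c.inl) = 0) : c.IsTrivial := by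
  obtain ⟨g, hg, hg0, hg2⟩ := c.exists_isMorseFunction_criticalSetOfIndex_zero_two_eq_empty
  -- the Morse count `χ(W, M) = #crit₀ - #crit₁ + #crit₂`
  have hg2' : criticalSetOfIndex (𝓡∂ (1 + 1)) g (1 + 1) = ∅ := hg2
  have hcount := hg.relEuler_eq_sum_ncard ℤ ℤ
  rw [hχ, Module.finrank_self, Nat.cast_one, mul_one, Finset.sum_range_succ,
    Finset.sum_range_succ, Finset.sum_range_one, hg0, hg2'] at hcount
  have h1card : ((criticalSetOfIndex (𝓡∂ (1 + 1)) g 1).ncard : ℤ) = 0 := by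
    simp only [ncard_empty, Nat.cast_zero, mul_zero, pow_one, zero_add, add_zero] at hcount
    linarith
  -- hence no critical point of index `1` either
  have hfin : (criticalSet (𝓡∂ (1 + 1)) g).Finite := IsMorse.finite_criticalSet_holds hg.isMorse
  have hg1 : criticalSetOfIndex (𝓡∂ (1 + 1)) g 1 = ∅ :=
    (Set.ncard_eq_zero (hfin.subset (criticalSetOfIndex_subset _ g 1))).1
      (by exact_mod_cast h1card)
  have hcrit : ∀ z, ¬ IsMCriticalPt (𝓡∂ (1 + 1)) g z := by
    intro z hz
    have hle : morseIndex (𝓡∂ (1 + 1)) g z ≤ 1 + 1 := by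
      simpa only [finrank_euclideanSpace_fin] using morseIndex_le_finrank (𝓡∂ (1 + 1)) g z
    have hcases : morseIndex (𝓡∂ (1 + 1)) g z = 0 ∨ morseIndex (𝓡∂ (1 + 1)) g z = 1 ∨
        morseIndex (𝓡∂ (1 + 1)) g z = 2 := by omega
    rcases hcases with hk | hk | hk
    · have hmem : z ∈ criticalSetOfIndex (𝓡∂ (1 + 1)) g 0 := ⟨hz, hk⟩
      rw [hg0] at hmem
      exact hmem
    · have hmem : z ∈ criticalSetOfIndex (𝓡∂ (1 + 1)) g 1 := ⟨hz, hk⟩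
      rw [hg1] at hmem
      exact hmem
    · have hmem : z ∈ criticalSetOfIndex (𝓡∂ (1 + 1)) g 2 := ⟨hz, hk⟩
      rw [hg2] at hmem
      exact hmem
  exact Cobordism.isTrivial_of_isMorseFunction_holds hg hcrit

/-- **The cylinder theorem, `χ(W) = 0` form.**  A connected surface cobordism `(W; M, N)` between
non-empty closed `1`-manifolds with `χ(W) = 0` is a product `W ≅ M × [0, 1]` relative to `M`:
`χ(W) = χ(M) + χ(W, M)` (exact sequence of the pair) and `χ(M) = 0` for the closed `1`-manifold
`M`. [cite: HirschDT1976, Ch. 9 §3, Thm. 3.7 and proof of Thm. 3.5 (PDF pp. 188–189)]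
[cite: MilnorHCobordism1965, Thm. 3.4, Thm. 8.1 Index 0 (PDF p. 54)] -/
theorem isTrivial_of_relEuler_empty_eq_zero (c : Cobordism 1 M N) [ConnectedSpace c.W]
    [Nonempty M] [Nonempty N] (hχ : relEuler ℤ ℤ c.W ∅ = 0) : c.IsTrivial := by
  have hM : relEuler ℤ ℤ M ∅ = 0 :=
    (finRelHomology_and_relEuler_eq_zero_of_even (n := 0) (Y := M) Even.zero).2
  have hsum := (c.relEuler_eq_relEuler_end_add).2
  rw [hχ, hM, zero_add] at hsum
  exact c.isTrivial_of_relEuler_eq_zero hsum.symm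

/-! ### The ends are circles; the annulus -/

/-- The incoming end of a connected product cobordism is connected (`W ≅ M × [0, 1]` and the
projection to `M` is a continuous surjection). [folklore] -/
theorem connectedSpace_of_isTrivial {n : ℕ} {M' N' : Type u} [TopologicalSpace M']
    [ChartedSpace (EuclideanSpace ℝ (Fin n)) M'] [TopologicalSpace N']
    [ChartedSpace (EuclideanSpace ℝ (Fin n)) N'] (c : Cobordism n M' N') [ConnectedSpace c.W]
    (hc : c.IsTrivial) : ConnectedSpace M' := by
  obtain ⟨Φ, -⟩ := hc
  have hsurj : Surjective (fun z : c.W => (Φ z).1) := fun x => by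
    obtain ⟨z, hz⟩ := Φ.surjective (x, ⊥)
    exact ⟨z, by simpa using congrArg Prod.fst hz⟩
  have hcont : Continuous (fun z : c.W => (Φ z).1) := continuous_fst.comp Φ.continuous
  exact hsurj.connectedSpace hcont

omit [T2Space N] [SecondCountableTopology N] [IsManifold (𝓡 1) ∞ N] [CompactSpace N] in
/-- **The incoming end of a connected product cobordism of surfaces is a circle**: it is a compact
connected `1`-manifold, orientable as every `1`-manifold (`OneManifold.isOrientable`), hence
diffeomorphic to `S¹` (Milnor 1965, Appendix; the tree's
`nonempty_diffeomorph_sphere_one_of_smoothOrientation`).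
[cite: MilnorHCobordism1965, Appendix (classification of 1-manifolds)] -/
theorem nonempty_diffeomorph_sphere_one_of_isTrivial (c : Cobordism 1 M N) [ConnectedSpace c.W]
    (hc : c.IsTrivial) :
    Nonempty (M ≃ₘ⟮𝓡 1, 𝓡 1⟯ (Metric.sphere (0 : EuclideanSpace ℝ (Fin (1 + 1))) 1)) := by
  haveI : ConnectedSpace M := c.connectedSpace_of_isTrivial hc
  obtain ⟨o⟩ := OneManifold.isOrientable (M := M)
  exact nonempty_diffeomorph_sphere_one_of_smoothOrientation o

/-- **The annulus (Hirsch 1976, Thm. 9.3.7, genus `0`, two boundary circles, in cobordism form).**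
A connected surface cobordism `(W; M, N)` between non-empty closed `1`-manifolds with
`χ(W, M) = 0` is diffeomorphic to the cylinder `S¹ × [0, 1]` (carrying Mathlib's product model
`(𝓡 1).prod (𝓡∂ 1)`): compose the product structure `W ≅ M × [0, 1]` of the cylinder theorem
with `M ≅ S¹`. [cite: HirschDT1976, Ch. 9 §3, Thm. 3.7 (PDF p. 189)]
[cite: MilnorHCobordism1965, Thm. 3.4, Thm. 8.1 Index 0, Appendix] -/
theorem nonempty_diffeomorph_sphere_one_prod_Icc_of_relEuler_eq_zero (c : Cobordism 1 M N)
    [ConnectedSpace c.W] [Nonempty M] [Nonempty N] (hχ : relEuler ℤ ℤ c.W (range c.inl) = 0) :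
    Nonempty (c.W ≃ₘ^∞⟮𝓡∂ (1 + 1), (𝓡 1).prod (𝓡∂ 1)⟯
      ((Metric.sphere (0 : EuclideanSpace ℝ (Fin (1 + 1))) 1) × (Set.Icc (0 : ℝ) 1))) := by
  have hc := c.isTrivial_of_relEuler_eq_zero hχ
  obtain ⟨e⟩ := c.nonempty_diffeomorph_sphere_one_of_isTrivial hc
  obtain ⟨Φ, -⟩ := hc
  exact ⟨Φ.trans (Diffeomorph.prodCongr e (Diffeomorph.refl _ _ _))⟩

/-- Under the hypotheses of the cylinder theorem the incoming end `M` is a circle.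
[cite: HirschDT1976, Ch. 9 §3, Thm. 3.7 (PDF p. 189)] -/
theorem nonempty_diffeomorph_sphere_one_of_relEuler_eq_zero (c : Cobordism 1 M N)
    [ConnectedSpace c.W] [Nonempty M] [Nonempty N] (hχ : relEuler ℤ ℤ c.W (range c.inl) = 0) :
    Nonempty (M ≃ₘ⟮𝓡 1, 𝓡 1⟯ (Metric.sphere (0 : EuclideanSpace ℝ (Fin (1 + 1))) 1)) :=
  c.nonempty_diffeomorph_sphere_one_of_isTrivial (c.isTrivial_of_relEuler_eq_zero hχ)

/-- Under the hypotheses of the cylinder theorem the outgoing end `N` is a circle too (the two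
ends of a product cobordism are diffeomorphic, `Cobordism.nonempty_diffeomorph_of_isTrivial_holds`).
[cite: HirschDT1976, Ch. 9 §3, Thm. 3.7 (PDF p. 189)] [cite: MilnorHCobordism1965, §1 and Thm. 3.4] -/
theorem nonempty_diffeomorph_sphere_one_right_of_relEuler_eq_zero (c : Cobordism 1 M N)
    [ConnectedSpace c.W] [Nonempty M] [Nonempty N] (hχ : relEuler ℤ ℤ c.W (range c.inl) = 0) :
    Nonempty (N ≃ₘ⟮𝓡 1, 𝓡 1⟯ (Metric.sphere (0 : EuclideanSpace ℝ (Fin (1 + 1))) 1)) := by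
  have hc := c.isTrivial_of_relEuler_eq_zero hχ
  obtain ⟨e⟩ := c.nonempty_diffeomorph_sphere_one_of_isTrivial hc
  obtain ⟨d⟩ := Cobordism.nonempty_diffeomorph_of_isTrivial_holds c hc
  exact ⟨d.symm.trans e⟩

end Cobordism

end Literature.Topology.FourManifolds

end
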